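import Summits.BirchSwinnertonDyer.BirchSwinnertonDyer.Theorems.AlignedTransportAtTwoMainConjectureOfRankZeroBSDAtTwoCubicLayerThreeRelationDoor
import Summits.BirchSwinnertonDyer.BirchSwinnertonDyer.Theorems.AlignedTransportAtTwoMainConjectureOfRankZeroBSDAtTwoCubicDoorsDeadSubcellClassNumberA
import Literature.NumberTheory.NumberFields.CubicFieldIntegers
import Literature.NumberTheory.NumberFields.CubicFieldResiduePrimes
import HarnessLib

/-!
# Route `AlignedTransportAtTwo`, crux C2 `MainConjectureOfRankZeroBSDAtTwo` (stmt-BirchSwinnertonDyer-22298):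
# ROW `N = 1259` BY THE RELATION ROAD: ★★★ **`rank₂ Cl(K_m) ≤ 5 ∀ m`, `μ₂ = 0`, `λ₂ ≤ 5` — UNCONDITIONALLY — for every cyclotomic `ℤ₂`-extension of the cubic
# `2`-torsion field `ℚ(β)` of `⟨1, -1, 1, -3, -2⟩`** (hard-core seed, `t = 3 ∧ e₁ = 1`, silent at every layer `≤ 2` and for the order-four door at EVERY layer), from ONE
# relation `c·σc·σ⁴c·σ⁵c = 1` in `Cl(K_3)`, `K_3 = ℚ(β)·ℚ(ζ₃₂)⁺` (degree `24`), certified by a principal generator with TWO-DIGIT coordinates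

HONEST FRAMING (cell `bsd-f1-sign2`, WIDTH-5 attached prover seat `bsd-line-att-p4` gen 43 on line `birth` of the lead `bsd-line-att-p2`;
`--supports` stmt-BirchSwinnertonDyer-22298, closes nothing; BSD is NOT proved by any of this; the crux C2, its verdict «blocked-on
`Rank1Residual.GreenbergMuConjectureIrreducible`» and every registered stub are untouched).  THEOREMS ONLY (no `def`, no named fact, no instance, no `sorry`).

WHAT.  `W = ⟨1, -1, 1, -3, -2⟩` (`N = 1259` prime, rank `0`, `Δ_min = −1259 ≡ 5 (mod 8)`, `Δ_W < 0`, good ordinary at `2`, `E[2]` irreducible) has the cubic `2`-torsion field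
`K = ℚ(β) = ℚ(θ)`, `θ = β² + β/4 − 1/4`, `f(θ) = 0`, `f = X³ − 5X² − X − 2` (att-p4 g38 `…CubicDoorsDeadSubcellClassNumberA`, `CubicDisc1259`: `h_K = 1`, `𝓞_K = ℤ[θ]`,
`d_K = −1259`).  It is a HARD-CORE seed of the u7 sub-cell: unit depth `t = 3` (`ε = 3 + 2θ + 8θ²`, `ε + 1 ∈ 𝔭₁³`, `𝔭₁ = (θ)`), `e₁ = 1`, and the `2`-class groups of
the layers `K_1, K_2, K_3` are ELEMENTARY (att-p4 g42 census: `Cl(K_3)[2^∞] ≅ (ℤ/2)⁵`) — no unit door, depth door or order-four door fires.  What fires is the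
RELATION ROAD (att-p3 g49's t-free door, this seat's g43 coordinate kernel `…CubicLayerThreeRelationDoor`): with `q₀ = −7 + 2θ` (norm `191`, `(q₀) = (191, θ − 99)`
maximal, `q₀ ≡ −3 (mod 𝔭₁³)`), `t = 113` (`P(113) ≡ 0 (mod 191)`, `t² − 2 ≡ t₂ = −30 (mod q₀)`), the degree-one prime `𝔠 = (q₀, s₃ − 113)` of `K_3` and the generator
`σ : s₃ ↦ s₃³ − 3s₃` of `Gal(K_3/K)`: **`𝔠·σ𝔠·σ⁴𝔠·σ⁵𝔠 = (q₀, 900 + s₁ + 30 s₁s₂) = (y)`**, `y = Σ yᵢbᵢ` with the TWO-DIGIT coordinates below (att-p4 g42's relation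
lattice datum `annih_n1259.json`, orbit `(191, 99)`, `D = 5`), `N_{K_3/K}(y) = ε_y q₀⁴`, `ε_y = −167 − 284θ + 60θ²` a unit — every identity decided by the kernel in
`ℤ[θ]` (one `linear_combination` against `f(θ) = 0` each), the residues by `decide` in `ℤ/191`, `ℤ/13`, `ℤ/2`.  Relation polynomial `1 + X + X⁴ + X⁵ = (X−1)⁵ + 2g`,
`d = 5 ≤ 2³ − 2`.  THEN (★★★ `classGroupPRank_le_five_and_mu_lambda_cubicField_n1259`, UNCONDITIONAL): for `β` ANY root of the `2`-division cubic and EVERY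
cyclotomic `ℤ₂`-extension `κ` of `ℚ(β)`: `rank₂ Cl(K_m) ≤ 5 ∀ m`, `μ₂(κ) = 0`, `λ₂(κ) ≤ 5`; and (★ `mazurMainConjecture_two_n1259_of_print`) `MC₂(W)` modulo PRINT⁵ + MuIneqʳ +
the crux's own hypotheses (att-p5 g24's carrier road).  Independent of the unit-door road (att-p3 g50's level-`64` lemma) and sharper in `λ`.
BSD is NOT proved; nothing is closed; C2's verdict is untouched.

References: [Washington1997] §13.1, §13.3 Prop. 13.22–13.23; [Lang1990] Ch. 13 §4 Lemma 4.1; [Fukuda1994] Thm. 1; [Gras2003] IV.4; [NeukirchANT1999] Ch. I §3, §8,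
Ch. III (1.6)–(1.7); [Cohen1993] §4.7, §6.5; [Marcus2018] Ch. 3 Thm. 27; [LMFDB] ec 1259.b, nf 3.1.1259.1; [Kato2004Asterisque] Thm. 17.4; [GreenbergLNM1716] Thm. 4.1; tree:
this seat's `…CubicLayerThreeRelationDoor`, `Literature/…/ClassicalMuVanishesLayerThreeRelationCertificateTwo`, `…/SqrtTwoTowerThreeGaloisAction`, att-p4 g38
`…CubicDoorsDeadSubcellClassNumberA`, `CubicDisc1259`, att-p5 g24 `…CubicCarrierRoad`.
-/

set_option linter.dupNamespace false
set_option autoImplicit false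

noncomputable section

open scoped Classical NumberField nonZeroDivisors IntermediateField

namespace Summit.BirchSwinnertonDyer.BirchSwinnertonDyer.Theorems.AlignedTransportAtTwoCubicLayerThreeRelationRowN1259

open NumberField IsDedekindDomain Polynomial WeierstrassCurve IntermediateField CongruenceSubgroup Module
  Literature.NumberTheory.IwasawaTheory Literature.NumberTheory.GaloisRepresentations
  Literature.NumberTheory.EllipticCurves Literature.NumberTheory.EllipticCurves.Greenberg1999
  Literature.NumberTheory.EllipticCurves.ModularForms Literature.NumberTheory.EllipticCurves.Rank1Residual
  Literature.NumberTheory.EllipticCurves.Module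
  Literature.NumberTheory.NumberFields Literature.NumberTheory.CubicFields
  Summit.BirchSwinnertonDyer.Rank1Residual Summit.BirchSwinnertonDyer.Rank1Residual.X1.MuLambda
  Summit.BirchSwinnertonDyer.Rank1Residual.X5 Summit.BirchSwinnertonDyer.Rank1Residual.X5.O1
  Summit.BirchSwinnertonDyer.Rank1Residual.X5.Instances Summit.BirchSwinnertonDyer.Rank1Residual.F1Sign2
  Summit.BirchSwinnertonDyer.BirchSwinnertonDyer.Theorems.Rank1ResidualX1Defs
  Summit.BirchSwinnertonDyer.BirchSwinnertonDyer.Theorems.AlignedTransportAtTwoCubicCarrierRoad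
  Summit.BirchSwinnertonDyer.BirchSwinnertonDyer.Theorems.AlignedTransportAtTwoCubicDoorsDeadSubcellClassNumberA
  Summit.BirchSwinnertonDyer.BirchSwinnertonDyer.Theorems.AlignedTransportAtTwoCubicLayerThreeRelationDoor

/-! ## §1 Residue maps of `𝓞_{ℚ(β)} = ℤ[θ]` -/

/-- `ψ₂ : 𝓞_{ℚ(β)} → ℤ/2` with `ψ₂(θ) = 0` (the dyadic prime `𝔭₁ = (2, θ) = (θ)` of norm `2`). [cite: Marcus2018, Ch. 3, Thm. 27] -/
theorem exists_residueHom_two {β : AlgebraicClosure ℚ} (hβ : aeval β ((⟨1, -1, 1, -3, -2⟩ : WeierstrassCurve ℤ).baseChange ℚ).twoTorsionPolynomial.toPoly = 0) :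
    ∃ ψ : 𝓞 ↥(IntermediateField.adjoin ℚ ({β} : Set (AlgebraicClosure ℚ))) →+* ZMod 2, ψ (MonicCubic.thetaInt (aeval_theta_n1259 hβ)) = (((0) : ℤ) : ZMod 2) :=
  haveI : FiniteDimensional ℚ ↥(IntermediateField.adjoin ℚ ({β} : Set (AlgebraicClosure ℚ))) := IntermediateField.adjoin.finiteDimensional ((AlgebraicClosure.isAlgebraic ℚ).isAlgebraic β).isIntegral
  haveI : NumberField ↥(IntermediateField.adjoin ℚ ({β} : Set (AlgebraicClosure ℚ))) := NumberField.mk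
  MonicCubic.exists_ringHom_of_root CubicDisc1259.irreducible_polyQ (aeval_theta_n1259 hβ) (finrank_cubicField_n1259 hβ)
    CubicDisc1259.isUnit_of_disc_eq_sq_mul (((0) : ℤ) : ZMod 2) (by decide)

/-- `ψ₁₃ : 𝓞_{ℚ(β)} → ℤ/13` with `ψ₁₃(θ) = 8` (`f(8) ≡ 0 (mod 13)`); used to see that `±ε` are non-squares (`ε ↦ 11`, `−ε ↦ 2`). [cite: Marcus2018, Ch. 3, Thm. 27] -/
theorem exists_residueHom_13 {β : AlgebraicClosure ℚ} (hβ : aeval β ((⟨1, -1, 1, -3, -2⟩ : WeierstrassCurve ℤ).baseChange ℚ).twoTorsionPolynomial.toPoly = 0) :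
    ∃ ψ : 𝓞 ↥(IntermediateField.adjoin ℚ ({β} : Set (AlgebraicClosure ℚ))) →+* ZMod 13, ψ (MonicCubic.thetaInt (aeval_theta_n1259 hβ)) = (8 : ZMod 13) :=
  haveI : FiniteDimensional ℚ ↥(IntermediateField.adjoin ℚ ({β} : Set (AlgebraicClosure ℚ))) := IntermediateField.adjoin.finiteDimensional ((AlgebraicClosure.isAlgebraic ℚ).isAlgebraic β).isIntegral
  haveI : NumberField ↥(IntermediateField.adjoin ℚ ({β} : Set (AlgebraicClosure ℚ))) := NumberField.mk
  MonicCubic.exists_ringHom_of_root CubicDisc1259.irreducible_polyQ (aeval_theta_n1259 hβ) (finrank_cubicField_n1259 hβ)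
    CubicDisc1259.isUnit_of_disc_eq_sq_mul (8 : ZMod 13) (by decide)

/-- `ψ₁₉₁ : 𝓞_{ℚ(β)} → ℤ/191` with `ψ₁₉₁(θ) = 99` — the degree-one prime `(191, θ − 99) = (q₀)`, `q₀ = −7 + 2θ`. [cite: Marcus2018, Ch. 3, Thm. 27] -/
theorem exists_residueHom_191 {β : AlgebraicClosure ℚ} (hβ : aeval β ((⟨1, -1, 1, -3, -2⟩ : WeierstrassCurve ℤ).baseChange ℚ).twoTorsionPolynomial.toPoly = 0) :
    ∃ ψ : 𝓞 ↥(IntermediateField.adjoin ℚ ({β} : Set (AlgebraicClosure ℚ))) →+* ZMod 191, ψ (MonicCubic.thetaInt (aeval_theta_n1259 hβ)) = ((99 : ℤ) : ZMod 191) :=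
  haveI : FiniteDimensional ℚ ↥(IntermediateField.adjoin ℚ ({β} : Set (AlgebraicClosure ℚ))) := IntermediateField.adjoin.finiteDimensional ((AlgebraicClosure.isAlgebraic ℚ).isAlgebraic β).isIntegral
  haveI : NumberField ↥(IntermediateField.adjoin ℚ ({β} : Set (AlgebraicClosure ℚ))) := NumberField.mk
  MonicCubic.exists_ringHom_of_root CubicDisc1259.irreducible_polyQ (aeval_theta_n1259 hβ) (finrank_cubicField_n1259 hβ)
    CubicDisc1259.isUnit_of_disc_eq_sq_mul ((99 : ℤ) : ZMod 191) (by decide)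

/-- **`N((−θ)) = 2`**: `(2, θ) = (−θ)` (`CubicDisc1259.span_2_lin0_eq`) is the kernel of `ψ₂`. [cite: Marcus2018, Ch. 3, Thm. 27] [cite: LMFDB, number field 3.1.1259.1] -/
theorem absNorm_span_negTheta_n1259 {β : AlgebraicClosure ℚ} (hβ : aeval β ((⟨1, -1, 1, -3, -2⟩ : WeierstrassCurve ℤ).baseChange ℚ).twoTorsionPolynomial.toPoly = 0) :
    haveI : FiniteDimensional ℚ ↥(IntermediateField.adjoin ℚ ({β} : Set (AlgebraicClosure ℚ))) := IntermediateField.adjoin.finiteDimensional ((AlgebraicClosure.isAlgebraic ℚ).isAlgebraic β).isIntegral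
    haveI : NumberField ↥(IntermediateField.adjoin ℚ ({β} : Set (AlgebraicClosure ℚ))) := NumberField.mk
    Ideal.absNorm (Ideal.span {-MonicCubic.thetaInt (aeval_theta_n1259 hβ)}) = 2 := by
  haveI : FiniteDimensional ℚ ↥(IntermediateField.adjoin ℚ ({β} : Set (AlgebraicClosure ℚ))) := IntermediateField.adjoin.finiteDimensional ((AlgebraicClosure.isAlgebraic ℚ).isAlgebraic β).isIntegral
  haveI : NumberField ↥(IntermediateField.adjoin ℚ ({β} : Set (AlgebraicClosure ℚ))) := NumberField.mk
  haveI : Fact (Nat.Prime 2) := ⟨Nat.prime_two⟩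
  have hθ := aeval_theta_n1259 hβ
  have h3 := finrank_cubicField_n1259 hβ
  obtain ⟨ψ, hψ⟩ := exists_residueHom_two hβ
  have hexp : ¬ 2 ∣ RingOfIntegers.exponent (MonicCubic.thetaInt hθ) := by
    rw [MonicCubic.exponent_thetaInt CubicDisc1259.irreducible_polyQ hθ h3 CubicDisc1259.isUnit_of_disc_eq_sq_mul]; decide
  have hker := MonicCubic.ker_residueHom_eq_span CubicDisc1259.irreducible_polyQ hθ hexp ψ hψ
  have hspan : Ideal.span {((2 : ℕ) : 𝓞 ↥(IntermediateField.adjoin ℚ ({β} : Set (AlgebraicClosure ℚ)))), MonicCubic.thetaInt hθ - (((0) : ℤ) : 𝓞 ↥(IntermediateField.adjoin ℚ ({β} : Set (AlgebraicClosure ℚ))))} = Ideal.span {-MonicCubic.thetaInt hθ} := by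
    rw [Nat.cast_ofNat, show MonicCubic.thetaInt hθ - (((0) : ℤ) : 𝓞 ↥(IntermediateField.adjoin ℚ ({β} : Set (AlgebraicClosure ℚ)))) = MonicCubic.thetaInt hθ by push_cast; ring]
    exact CubicDisc1259.span_2_lin0_eq hθ
  rw [← hspan, ← hker]
  exact absNorm_ker_zmod ψ

/-- **`(q₀) = (191, θ − 99)` is a maximal ideal** (`q₀ = −7 + 2θ = 191 + 2(θ − 99)`, `191 = q₀·(−25 − 6θ + 4θ²)`, `θ − 99 = q₀·(13 + 3θ − 2θ²)`; the kernel of `ψ₁₉₁`).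
[cite: Marcus2018, Ch. 3, Thm. 27] -/
theorem isMaximal_span_q0_n1259 {β : AlgebraicClosure ℚ} (hβ : aeval β ((⟨1, -1, 1, -3, -2⟩ : WeierstrassCurve ℤ).baseChange ℚ).twoTorsionPolynomial.toPoly = 0) :
    haveI : FiniteDimensional ℚ ↥(IntermediateField.adjoin ℚ ({β} : Set (AlgebraicClosure ℚ))) := IntermediateField.adjoin.finiteDimensional ((AlgebraicClosure.isAlgebraic ℚ).isAlgebraic β).isIntegral
    haveI : NumberField ↥(IntermediateField.adjoin ℚ ({β} : Set (AlgebraicClosure ℚ))) := NumberField.mk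
    (Ideal.span {((-7) + 2 * MonicCubic.thetaInt (aeval_theta_n1259 hβ) : 𝓞 ↥(IntermediateField.adjoin ℚ ({β} : Set (AlgebraicClosure ℚ))))}).IsMaximal := by
  haveI : FiniteDimensional ℚ ↥(IntermediateField.adjoin ℚ ({β} : Set (AlgebraicClosure ℚ))) := IntermediateField.adjoin.finiteDimensional ((AlgebraicClosure.isAlgebraic ℚ).isAlgebraic β).isIntegral
  haveI : NumberField ↥(IntermediateField.adjoin ℚ ({β} : Set (AlgebraicClosure ℚ))) := NumberField.mk
  haveI : Fact (Nat.Prime 191) := ⟨by norm_num⟩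
  have hθ := aeval_theta_n1259 hβ
  have h3 := finrank_cubicField_n1259 hβ
  obtain ⟨ψ, hψ⟩ := exists_residueHom_191 hβ
  set θI : 𝓞 ↥(IntermediateField.adjoin ℚ ({β} : Set (AlgebraicClosure ℚ))) := MonicCubic.thetaInt hθ with hθI
  have hrel : θI ^ 3 + (-5 : 𝓞 ↥(IntermediateField.adjoin ℚ ({β} : Set (AlgebraicClosure ℚ)))) * θI ^ 2 + (-1 : 𝓞 ↥(IntermediateField.adjoin ℚ ({β} : Set (AlgebraicClosure ℚ)))) * θI + (-2 : 𝓞 ↥(IntermediateField.adjoin ℚ ({β} : Set (AlgebraicClosure ℚ)))) = 0 := by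
    have h := MonicCubic.thetaInt_rel hθ
    rw [← hθI] at h
    push_cast at h
    linear_combination h
  have hexp : ¬ 191 ∣ RingOfIntegers.exponent (MonicCubic.thetaInt hθ) := by
    rw [MonicCubic.exponent_thetaInt CubicDisc1259.irreducible_polyQ hθ h3 CubicDisc1259.isUnit_of_disc_eq_sq_mul]; decide
  have hker := MonicCubic.ker_residueHom_eq_span CubicDisc1259.irreducible_polyQ hθ hexp ψ hψ
  have hspan : Ideal.span {((191 : ℕ) : 𝓞 ↥(IntermediateField.adjoin ℚ ({β} : Set (AlgebraicClosure ℚ)))), MonicCubic.thetaInt hθ - ((99 : ℤ) : 𝓞 ↥(IntermediateField.adjoin ℚ ({β} : Set (AlgebraicClosure ℚ))))} = Ideal.span {((-7) + 2 * θI : 𝓞 ↥(IntermediateField.adjoin ℚ ({β} : Set (AlgebraicClosure ℚ))))} := by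
    rw [← hθI]
    apply le_antisymm
    · rw [Ideal.span_le]
      intro x hx
      simp only [Set.mem_insert_iff, Set.mem_singleton_iff] at hx
      rcases hx with rfl | rfl
      · exact Ideal.mem_span_singleton'.mpr ⟨((-25) + (-6) * θI + 4 * θI ^ 2 : 𝓞 ↥(IntermediateField.adjoin ℚ ({β} : Set (AlgebraicClosure ℚ)))), by push_cast; linear_combination (8 : 𝓞 ↥(IntermediateField.adjoin ℚ ({β} : Set (AlgebraicClosure ℚ)))) * hrel⟩
      · exact Ideal.mem_span_singleton'.mpr ⟨(13 + 3 * θI + (-2) * θI ^ 2 : 𝓞 ↥(IntermediateField.adjoin ℚ ({β} : Set (AlgebraicClosure ℚ)))), by push_cast; linear_combination ((-4) : 𝓞 ↥(IntermediateField.adjoin ℚ ({β} : Set (AlgebraicClosure ℚ)))) * hrel⟩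
    · rw [Ideal.span_singleton_le_iff_mem, Ideal.mem_span_pair]
      exact ⟨1, 2, by push_cast; ring⟩
  rw [← hspan, ← hker]
  exact ker_zmod_isMaximal ψ

/-! ## §2 ★★★ The relation row: `rank₂ ≤ 5`, `μ₂ = 0`, `λ₂ ≤ 5` — UNCONDITIONAL -/

set_option maxHeartbeats 4000000 in
/-- ★★★ **`rank₂ Cl(K_m) ≤ 5 ∀ m`, `μ₂ = 0`, `λ₂ ≤ 5` — UNCONDITIONAL — for every cyclotomic `ℤ₂`-extension of the cubic `2`-torsion field of `⟨1, -1, 1, -3, -2⟩`**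
(`N = 1259`, hard core): the layer-three relation door in coordinates with the datum `q₀ = −7 + 2θ`, `t = 113`, `t₂ = −30`, `y` (two-digit coordinates), `N(y) = ε_y q₀⁴`.
[cite: Washington1997, §13.3 Prop. 13.22–13.23] [cite: Lang1990, Ch. 13 §4 Lemma 4.1] [cite: Fukuda1994, Thm. 1, p. 264] [cite: Cohen1993, §6.5] [cite: LMFDB, number field 3.1.1259.1] -/
theorem classGroupPRank_le_five_and_mu_lambda_cubicField_n1259 {β : AlgebraicClosure ℚ} (hβ : aeval β ((⟨1, -1, 1, -3, -2⟩ : WeierstrassCurve ℤ).baseChange ℚ).twoTorsionPolynomial.toPoly = 0)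
    (κP : ZpExtension ↥(IntermediateField.adjoin ℚ ({β} : Set (AlgebraicClosure ℚ))) 2) (hκP : κP.IsCyclotomic) :
    (∀ m, classGroupPRank κP m ≤ 5) ∧ ClassicalMuVanishes κP ∧ classicalLambda κP ≤ 5 := by
  haveI := isElliptic_n1259
  haveI := isGloballyMinimal_n1259
  haveI : FiniteDimensional ℚ ↥(IntermediateField.adjoin ℚ ({β} : Set (AlgebraicClosure ℚ))) := IntermediateField.adjoin.finiteDimensional ((AlgebraicClosure.isAlgebraic ℚ).isAlgebraic β).isIntegral
  haveI : NumberField ↥(IntermediateField.adjoin ℚ ({β} : Set (AlgebraicClosure ℚ))) := NumberField.mk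
  have hord : IsOrdinaryAt ((⟨1, -1, 1, -3, -2⟩ : WeierstrassCurve ℤ).baseChange ℚ) 2 := goodOrd_two_n1259
  have ht := not_hasRationalTwoTorsionX_n1259
  have hθ := aeval_theta_n1259 hβ
  have h3 := finrank_cubicField_n1259 hβ
  have hd : ¬ (2 : ℤ) ∣ NumberField.discr ↥(IntermediateField.adjoin ℚ ({β} : Set (AlgebraicClosure ℚ))) := by
    rw [CubicDisc1259.discr_eq h3 hθ]; norm_num
  obtain ⟨ψ, hψ⟩ := exists_residueHom_191 hβ
  obtain ⟨χ, hχ⟩ := exists_residueHom_13 hβ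
  have hmax := isMaximal_span_q0_n1259 hβ
  have hN2 := absNorm_span_negTheta_n1259 hβ
  set θI : 𝓞 ↥(IntermediateField.adjoin ℚ ({β} : Set (AlgebraicClosure ℚ))) := MonicCubic.thetaInt hθ with hθI
  have hrel : θI ^ 3 + (-5 : 𝓞 ↥(IntermediateField.adjoin ℚ ({β} : Set (AlgebraicClosure ℚ)))) * θI ^ 2 + (-1 : 𝓞 ↥(IntermediateField.adjoin ℚ ({β} : Set (AlgebraicClosure ℚ)))) * θI + (-2 : 𝓞 ↥(IntermediateField.adjoin ℚ ({β} : Set (AlgebraicClosure ℚ)))) = 0 := by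
    have h := MonicCubic.thetaInt_rel hθ
    rw [← hθI] at h
    push_cast at h
    linear_combination h
  -- the unit `ε = 3 + 2θ + 8θ²` (`t = 3`): `ε·(−5 + 22θ − 4θ²) = 1`, `ε + 1 ∈ 𝔭₁³`, `±ε` non-squares (at `ψ₁₃`)
  have hεmul : ((3 + 2 * θI + 8 * θI ^ 2 : 𝓞 ↥(IntermediateField.adjoin ℚ ({β} : Set (AlgebraicClosure ℚ))))) * (((-5) + 22 * θI + (-4) * θI ^ 2 : 𝓞 ↥(IntermediateField.adjoin ℚ ({β} : Set (AlgebraicClosure ℚ))))) = 1 := by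
    linear_combination (8 + (-32) * θI : 𝓞 ↥(IntermediateField.adjoin ℚ ({β} : Set (AlgebraicClosure ℚ)))) * hrel
  have hχε : χ ((3 + 2 * θI + 8 * θI ^ 2 : 𝓞 ↥(IntermediateField.adjoin ℚ ({β} : Set (AlgebraicClosure ℚ))))) = (11 : ZMod 13) := by
    simp only [map_add, map_mul, map_pow, map_ofNat, hχ]; decide
  have hnsq : ∀ z : (𝓞 ↥(IntermediateField.adjoin ℚ ({β} : Set (AlgebraicClosure ℚ))))ˣ, Units.mkOfMulEqOne _ _ hεmul ≠ z ^ 2 ∧ Units.mkOfMulEqOne _ _ hεmul ≠ -z ^ 2 := by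
    intro z
    refine ⟨fun h => ?_, fun h => ?_⟩
    · have h' := congrArg (fun w : (𝓞 ↥(IntermediateField.adjoin ℚ ({β} : Set (AlgebraicClosure ℚ))))ˣ => χ (w : 𝓞 ↥(IntermediateField.adjoin ℚ ({β} : Set (AlgebraicClosure ℚ))))) h
      simp only [Units.val_mkOfMulEqOne, Units.val_pow_eq_pow_val, map_pow] at h'
      rw [hχε] at h'
      exact absurd h'.symm (by generalize χ (z : 𝓞 ↥(IntermediateField.adjoin ℚ ({β} : Set (AlgebraicClosure ℚ)))) = u; revert u; decide)
    · have h' := congrArg (fun w : (𝓞 ↥(IntermediateField.adjoin ℚ ({β} : Set (AlgebraicClosure ℚ))))ˣ => χ (w : 𝓞 ↥(IntermediateField.adjoin ℚ ({β} : Set (AlgebraicClosure ℚ))))) h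
      simp only [Units.val_mkOfMulEqOne, Units.val_neg, Units.val_pow_eq_pow_val, map_neg, map_pow] at h'
      rw [hχε] at h'
      exact absurd h'.symm (by generalize χ (z : 𝓞 ↥(IntermediateField.adjoin ℚ ({β} : Set (AlgebraicClosure ℚ)))) = u; revert u; decide)
  have hε : (Units.mkOfMulEqOne _ _ hεmul : (𝓞 ↥(IntermediateField.adjoin ℚ ({β} : Set (AlgebraicClosure ℚ))))ˣ).val - 1 ∈ Ideal.span {-θI} ^ 3 ∨ (Units.mkOfMulEqOne _ _ hεmul : (𝓞 ↥(IntermediateField.adjoin ℚ ({β} : Set (AlgebraicClosure ℚ))))ˣ).val + 1 ∈ Ideal.span {-θI} ^ 3 := by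
    refine Or.inr ?_
    rw [Units.val_mkOfMulEqOne, Ideal.span_singleton_pow, Ideal.mem_span_singleton']
    exact ⟨((-3) + (-5) * θI + 1 * θI ^ 2 : 𝓞 ↥(IntermediateField.adjoin ℚ ({β} : Set (AlgebraicClosure ℚ)))), by linear_combination (2 + (-1) * θI ^ 2 : 𝓞 ↥(IntermediateField.adjoin ℚ ({β} : Set (AlgebraicClosure ℚ)))) * hrel⟩
  -- `q₀ = −7 + 2θ ≡ −3 (mod 𝔭₁³)`
  have hπ : (((-7) + 2 * θI : 𝓞 ↥(IntermediateField.adjoin ℚ ({β} : Set (AlgebraicClosure ℚ))))) - 3 ∈ Ideal.span {-θI} ^ 3 ∨ (((-7) + 2 * θI : 𝓞 ↥(IntermediateField.adjoin ℚ ({β} : Set (AlgebraicClosure ℚ))))) + 3 ∈ Ideal.span {-θI} ^ 3 := by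
    refine Or.inr ?_
    rw [Ideal.span_singleton_pow, Ideal.mem_span_singleton']
    exact ⟨(16 + 18 * θI + (-4) * θI ^ 2 : 𝓞 ↥(IntermediateField.adjoin ℚ ({β} : Set (AlgebraicClosure ℚ)))), by linear_combination ((-2) + 2 * θI + 4 * θI ^ 2 : 𝓞 ↥(IntermediateField.adjoin ℚ ({β} : Set (AlgebraicClosure ℚ)))) * hrel⟩
  have hψq : ψ (((-7) + 2 * θI : 𝓞 ↥(IntermediateField.adjoin ℚ ({β} : Set (AlgebraicClosure ℚ))))) = 0 := by
    simp only [map_add, map_mul, map_neg, map_ofNat, hψ]; decide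
  -- the norm unit `ε_y = −167 − 284θ + 60θ²`
  have hεy : (((-167) + (-284) * θI + 60 * θI ^ 2 : 𝓞 ↥(IntermediateField.adjoin ℚ ({β} : Set (AlgebraicClosure ℚ))))) * ((713 + 492 * θI + 1876 * θI ^ 2 : 𝓞 ↥(IntermediateField.adjoin ℚ ({β} : Set (AlgebraicClosure ℚ))))) = 1 := by
    linear_combination (59536 + 112560 * θI : 𝓞 ↥(IntermediateField.adjoin ℚ ({β} : Set (AlgebraicClosure ℚ)))) * hrel
  exact AlignedTransportAtTwoCubicLayerThreeRelationDoor.classicalMuVanishes_adjoin_of_relationCert_layer_three ((⟨1, -1, 1, -3, -2⟩ : WeierstrassCurve ℤ).baseChange ℚ) hord ht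
    minimalDiscriminantInt_emod_eight_n1259 Δ_n1259_neg hβ (not_two_dvd_classNumber_cubicField_n1259 hβ) hd (Ideal.span {-θI}) hN2 hε hnsq κP hκP
    (((-7) + 2 * θI : 𝓞 ↥(IntermediateField.adjoin ℚ ({β} : Set (AlgebraicClosure ℚ))))) hmax hπ 113 (-30) (((-1675) + (-402) * θI + 268 * θI ^ 2 : 𝓞 ↥(IntermediateField.adjoin ℚ ({β} : Set (AlgebraicClosure ℚ))))) (by push_cast; linear_combination ((-536) : 𝓞 ↥(IntermediateField.adjoin ℚ ({β} : Set (AlgebraicClosure ℚ)))) * hrel)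
    (q := 191) (by norm_num) ψ hψq (ti := 96) (by decide) (by decide)
    ((804437707235954 + (-2412800095023511) * θI + (-1907355780165273) * θI ^ 2 : 𝓞 ↥(IntermediateField.adjoin ℚ ({β} : Set (AlgebraicClosure ℚ))))) ((280473 + 1031607 * θI + (-204073) * θI ^ 2 : 𝓞 ↥(IntermediateField.adjoin ℚ ({β} : Set (AlgebraicClosure ℚ))))) (by push_cast; linear_combination ((-6044485472400532283376) + 1573052427883712529136 * θI + 1337065611446140382144 * θI ^ 2 + (-1264844254306946409056) * θI ^ 3 + 477352970814526120960 * θI ^ 4 + (-97404322243858127360) * θI ^ 5 + 10612834009287108608 * θI ^ 6 + (-488283079722309888) * θI ^ 7 : 𝓞 ↥(IntermediateField.adjoin ℚ ({β} : Set (AlgebraicClosure ℚ)))) * hrel)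
    (((-1775) + (-426) * θI + 284 * θI ^ 2 : 𝓞 ↥(IntermediateField.adjoin ℚ ({β} : Set (AlgebraicClosure ℚ))))) (-60) (by push_cast; linear_combination (568 : 𝓞 ↥(IntermediateField.adjoin ℚ ({β} : Set (AlgebraicClosure ℚ)))) * hrel)
    ((79550625 + 19092150 * θI + (-12728100) * θI ^ 2 : 𝓞 ↥(IntermediateField.adjoin ℚ ({β} : Set (AlgebraicClosure ℚ))))) (47) (by push_cast; linear_combination ((-25456200) : 𝓞 ↥(IntermediateField.adjoin ℚ ({β} : Set (AlgebraicClosure ℚ)))) * hrel)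
    (23 + (-6) * θI + 68 * θI ^ 2 : 𝓞 ↥(IntermediateField.adjoin ℚ ({β} : Set (AlgebraicClosure ℚ)))) ((-19) + (-22) * θI + (-43) * θI ^ 2 : 𝓞 ↥(IntermediateField.adjoin ℚ ({β} : Set (AlgebraicClosure ℚ)))) ((-32) + (-22) * θI + (-83) * θI ^ 2 : 𝓞 ↥(IntermediateField.adjoin ℚ ({β} : Set (AlgebraicClosure ℚ)))) (25 + 24 * θI + 57 * θI ^ 2 : 𝓞 ↥(IntermediateField.adjoin ℚ ({β} : Set (AlgebraicClosure ℚ)))) (28 + 52 * θI + 50 * θI ^ 2 : 𝓞 ↥(IntermediateField.adjoin ℚ ({β} : Set (AlgebraicClosure ℚ)))) ((-10) + 12 * θI + (-45) * θI ^ 2 : 𝓞 ↥(IntermediateField.adjoin ℚ ({β} : Set (AlgebraicClosure ℚ)))) ((-29) + (-34) * θI + (-72) * θI ^ 2 : 𝓞 ↥(IntermediateField.adjoin ℚ ({β} : Set (AlgebraicClosure ℚ)))) (17 + (-2) * θI + 56 * θI ^ 2 : 𝓞 ↥(IntermediateField.adjoin ℚ ({β} : Set (AlgebraicClosure ℚ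))))
    (47 + (-98) * θI + 88 * θI ^ 2 : 𝓞 ↥(IntermediateField.adjoin ℚ ({β} : Set (AlgebraicClosure ℚ)))) (33 + (-101) * θI + 53 * θI ^ 2 : 𝓞 ↥(IntermediateField.adjoin ℚ ({β} : Set (AlgebraicClosure ℚ)))) ((-44) + 86 * θI + (-85) * θI ^ 2 : 𝓞 ↥(IntermediateField.adjoin ℚ ({β} : Set (AlgebraicClosure ℚ)))) (45 + (-99) * θI + 85 * θI ^ 2 : 𝓞 ↥(IntermediateField.adjoin ℚ ({β} : Set (AlgebraicClosure ℚ)))) ((-138) + (-28) * θI + 36 * θI ^ 2 : 𝓞 ↥(IntermediateField.adjoin ℚ ({β} : Set (AlgebraicClosure ℚ)))) ((-9) + 72 * θI + 237 * θI ^ 2 : 𝓞 ↥(IntermediateField.adjoin ℚ ({β} : Set (AlgebraicClosure ℚ)))) ((-163) + 72 * θI + (-52) * θI ^ 2 : 𝓞 ↥(IntermediateField.adjoin ℚ ({β} : Set (AlgebraicClosure ℚ)))) ((-116) + (-23) * θI + 34 * θI ^ 2 : 𝓞 ↥(IntermediateField.adjoin ℚ ({β} : Set (AlgebraicClosure ℚ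))))
    ((-1) * θI : 𝓞 ↥(IntermediateField.adjoin ℚ ({β} : Set (AlgebraicClosure ℚ)))) ((-1) * θI : 𝓞 ↥(IntermediateField.adjoin ℚ ({β} : Set (AlgebraicClosure ℚ)))) (1 * θI : 𝓞 ↥(IntermediateField.adjoin ℚ ({β} : Set (AlgebraicClosure ℚ)))) ((-1) * θI : 𝓞 ↥(IntermediateField.adjoin ℚ ({β} : Set (AlgebraicClosure ℚ)))) ((-1) : 𝓞 ↥(IntermediateField.adjoin ℚ ({β} : Set (AlgebraicClosure ℚ)))) ((-1) + (-1) * θI ^ 2 : 𝓞 ↥(IntermediateField.adjoin ℚ ({β} : Set (AlgebraicClosure ℚ)))) ((-1) + 1 * θI : 𝓞 ↥(IntermediateField.adjoin ℚ ({β} : Set (AlgebraicClosure ℚ)))) ((-1) : 𝓞 ↥(IntermediateField.adjoin ℚ ({β} : Set (AlgebraicClosure ℚ))))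
    (by push_cast; linear_combination ((-176) : 𝓞 ↥(IntermediateField.adjoin ℚ ({β} : Set (AlgebraicClosure ℚ)))) * hrel)
    (by push_cast; linear_combination ((-106) : 𝓞 ↥(IntermediateField.adjoin ℚ ({β} : Set (AlgebraicClosure ℚ)))) * hrel)
    (by push_cast; linear_combination (170 : 𝓞 ↥(IntermediateField.adjoin ℚ ({β} : Set (AlgebraicClosure ℚ)))) * hrel)
    (by push_cast; linear_combination ((-170) : 𝓞 ↥(IntermediateField.adjoin ℚ ({β} : Set (AlgebraicClosure ℚ)))) * hrel)
    (by push_cast; linear_combination ((-72) : 𝓞 ↥(IntermediateField.adjoin ℚ ({β} : Set (AlgebraicClosure ℚ)))) * hrel)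
    (by push_cast; linear_combination ((-474) : 𝓞 ↥(IntermediateField.adjoin ℚ ({β} : Set (AlgebraicClosure ℚ)))) * hrel)
    (by push_cast; linear_combination (104 : 𝓞 ↥(IntermediateField.adjoin ℚ ({β} : Set (AlgebraicClosure ℚ)))) * hrel)
    (by push_cast; linear_combination ((-68) : 𝓞 ↥(IntermediateField.adjoin ℚ ({β} : Set (AlgebraicClosure ℚ)))) * hrel)
    ((-101) + (-4) * θI : 𝓞 ↥(IntermediateField.adjoin ℚ ({β} : Set (AlgebraicClosure ℚ)))) ((-72) + 9 * θI + 4 * θI ^ 2 : 𝓞 ↥(IntermediateField.adjoin ℚ ({β} : Set (AlgebraicClosure ℚ)))) (14 + (-46) * θI + 14 * θI ^ 2 : 𝓞 ↥(IntermediateField.adjoin ℚ ({β} : Set (AlgebraicClosure ℚ)))) (3 + (-22) * θI : 𝓞 ↥(IntermediateField.adjoin ℚ ({β} : Set (AlgebraicClosure ℚ)))) (24277 + 4536 * θI + (-1742) * θI ^ 2 : 𝓞 ↥(IntermediateField.adjoin ℚ ({β} : Set (AlgebraicClosure ℚ)))) (17178 + 3210 * θI + (-1228) * θI ^ 2 :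 𝓞 ↥(IntermediateField.adjoin ℚ ({β} : Set (AlgebraicClosure ℚ))))
    (by linear_combination (272 + 96 * θI : 𝓞 ↥(IntermediateField.adjoin ℚ ({β} : Set (AlgebraicClosure ℚ)))) * hrel)
    (by linear_combination ((-131) + (-79) * θI : 𝓞 ↥(IntermediateField.adjoin ℚ ({β} : Set (AlgebraicClosure ℚ)))) * hrel)
    (by linear_combination ((-314) + (-134) * θI : 𝓞 ↥(IntermediateField.adjoin ℚ ({β} : Set (AlgebraicClosure ℚ)))) * hrel)
    (by linear_combination (206 + 98 * θI : 𝓞 ↥(IntermediateField.adjoin ℚ ({β} : Set (AlgebraicClosure ℚ)))) * hrel)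
    (by linear_combination ((-2152) + 360 * θI : 𝓞 ↥(IntermediateField.adjoin ℚ ({β} : Set (AlgebraicClosure ℚ)))) * hrel)
    (by linear_combination ((-1508) + 196 * θI : 𝓞 ↥(IntermediateField.adjoin ℚ ({β} : Set (AlgebraicClosure ℚ)))) * hrel)
    (Units.mkOfMulEqOne _ _ hεy) (by rw [Units.val_mkOfMulEqOne]; linear_combination (196836 + (-47948) * θI + 13184 * θI ^ 2 + (-960) * θI ^ 3 : 𝓞 ↥(IntermediateField.adjoin ℚ ({β} : Set (AlgebraicClosure ℚ)))) * hrel)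

/-- ★★ **`μ₂(κ) = 0` — UNCONDITIONAL — for every cyclotomic `ℤ₂`-extension `κ` of the cubic field of discriminant `−1259`**, by the relation road.
[cite: Washington1997, §13.3] [cite: LMFDB, number field 3.1.1259.1] -/
theorem classicalMuVanishes_cubicField_n1259_unconditional {β : AlgebraicClosure ℚ} (hβ : aeval β ((⟨1, -1, 1, -3, -2⟩ : WeierstrassCurve ℤ).baseChange ℚ).twoTorsionPolynomial.toPoly = 0)
    (κP : ZpExtension ↥(IntermediateField.adjoin ℚ ({β} : Set (AlgebraicClosure ℚ))) 2) (hκP : κP.IsCyclotomic) : ClassicalMuVanishes κP :=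
  (classGroupPRank_le_five_and_mu_lambda_cubicField_n1259 hβ κP hκP).2.1

/-! ## §3 `MC₂(W)` at the seed modulo PRINT (att-p5 g24's cubic carrier road with its `μ₂ = 0` input DISCHARGED) -/

/-- The `2`-division cubic of `⟨1, -1, 1, -3, -2⟩` has a root in `ℚ̄`. [cite: SilvermanAEC2009, III.1] -/
theorem exists_root_twoTorsionPolynomial_n1259 :
    ∃ β : AlgebraicClosure ℚ, aeval β ((⟨1, -1, 1, -3, -2⟩ : WeierstrassCurve ℤ).baseChange ℚ).twoTorsionPolynomial.toPoly = 0 := by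
  apply IsAlgClosed.exists_aeval_eq_zero
  rw [Cubic.degree_of_a_ne_zero (by simp [WeierstrassCurve.twoTorsionPolynomial])]
  decide

/-- ★ **`C2` AT THE SEED `⟨1, -1, 1, -3, -2⟩` (`N = 1259`) modulo PRINT⁵ + MuIneqʳ + the crux's own hypotheses at this `W`** — att-p5 g24's carrier road
(`Δ_W < 0`, good ordinary at `2`, no rational `2`-torsion) with its `μ₂ = 0` input DISCHARGED by the relation row: `MazurMainConjecture W 2` from {`h17` Kato 17.4 at `2`,
`hGr` Greenberg 4.1, `hper`, `hmod`, `hGZK`} + `hI` = MuIneqʳ (registered stub of line `birth`, verbatim) + `r_an(W) = 0`, analytic `μ₂ = 0` on the even branch, `BSD₂(W)`.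
CONDITIONAL; BSD is NOT proved; nothing is closed. [cite: Kato2004Asterisque, Thm. 17.4 (1)(2) (p. 273)] [cite: GreenbergLNM1716, Thm. 4.1 (p. 102) and Conj. 1.11 (p. 58)]
[cite: Iwasawa1973MuInvariants, Thm. 2 and Thm. 3] -/
theorem mazurMainConjecture_two_n1259_of_print
    [((⟨1, -1, 1, -3, -2⟩ : WeierstrassCurve ℤ).baseChange ℚ).IsElliptic] [((⟨1, -1, 1, -3, -2⟩ : WeierstrassCurve ℤ).baseChange ℚ).IsGloballyMinimal]
    (h17 : ∀ [NeZero (((⟨1, -1, 1, -3, -2⟩ : WeierstrassCurve ℤ).baseChange ℚ).conductorNorm ℤ)] (f : CuspForm (Gamma0 (((⟨1, -1, 1, -3, -2⟩ : WeierstrassCurve ℤ).baseChange ℚ).conductorNorm ℤ)) 2),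
      kato_divisibility_allPrimes ((⟨1, -1, 1, -3, -2⟩ : WeierstrassCurve ℤ).baseChange ℚ) 2 (f := f))
    (hGr : Greenberg1999.thm41_charValue_rankZero_anyPrime)
    (hper : realPeriodRat_eq_unit_mul_plusPeriod_two) (hmod : nonempty_modularParametrizationData)
    (hGZK : rank_eq_analyticRank_of_analyticRank_le_one)
    (hI : ∀ (W : WeierstrassCurve ℚ) [W.IsElliptic] [W.IsGloballyMinimal], IsOrdinaryAt W 2 →
      (∀ x : ℚ, ¬ HasRationalTwoTorsionX W x) →
      ∀ (κ : ZpExtension ℚ 2) (γ : Field.absoluteGaloisGroup ℚ), κ.IsCyclotomic →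
      κ.IsTopGenerator γ → IsCyclotomicVariable 2 γ →
      ∀ ⦃N : ℕ⦄ [NeZero N] (f : CuspForm (Gamma0 N) 2), IsNewformOf W f →
      ∀ Gp : IwasawaAlgebra 2, iwasawaToPowerSeries 2 Gp = padicLFunction f (unitRoot W 2 : ℚ_[2]) →
      ∀ (D : W.SelmerDualData κ γ) (Yr : W.FineSelmerDualDataRelaxedInf κ γ),
        lengthAt (IwasawaAlgebra 2) D.X ⟨IwasawaAlgebra.augIdealP 2, IwasawaAlgebra.isPrime_augIdealP_holds 2⟩ ≤
          lengthAt (IwasawaAlgebra 2) (IwasawaAlgebra 2 ⧸ Ideal.span {Gp})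
              ⟨IwasawaAlgebra.augIdealP 2, IwasawaAlgebra.isPrime_augIdealP_holds 2⟩ +
            lengthAt (IwasawaAlgebra 2) Yr.X ⟨IwasawaAlgebra.augIdealP 2, IwasawaAlgebra.isPrime_augIdealP_holds 2⟩)
    (hr : ((⟨1, -1, 1, -3, -2⟩ : WeierstrassCurve ℤ).baseChange ℚ).analyticRank = 0)
    (hμan : ∀ ⦃N : ℕ⦄ [NeZero N] (f : CuspForm (Gamma0 N) 2), IsNewformOf ((⟨1, -1, 1, -3, -2⟩ : WeierstrassCurve ℤ).baseChange ℚ) f →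
      ∀ G : IwasawaAlgebra 2, IsEvenBranchLiftAtTwo ((⟨1, -1, 1, -3, -2⟩ : WeierstrassCurve ℤ).baseChange ℚ) f G → red G ≠ 0)
    (hbsd : BSDp ((⟨1, -1, 1, -3, -2⟩ : WeierstrassCurve ℤ).baseChange ℚ) 2) :
    MazurMainConjecture ((⟨1, -1, 1, -3, -2⟩ : WeierstrassCurve ℤ).baseChange ℚ) 2 := by
  obtain ⟨β, hβ⟩ := exists_root_twoTorsionPolynomial_n1259
  have hord : IsOrdinaryAt ((⟨1, -1, 1, -3, -2⟩ : WeierstrassCurve ℤ).baseChange ℚ) 2 := goodOrd_two_n1259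
  exact mazurMainConjecture_two_of_muIneqRel_of_classicalMu_cubicField_of_Δ_neg ((⟨1, -1, 1, -3, -2⟩ : WeierstrassCurve ℤ).baseChange ℚ) h17 hGr hper hmod hGZK hI hord
    not_hasRationalTwoTorsionX_n1259 Δ_n1259_neg hr hμan hbsd hβ (fun κP hκP =>
      (classGroupPRank_le_five_and_mu_lambda_cubicField_n1259 hβ κP hκP).2.1)

end Summit.BirchSwinnertonDyer.BirchSwinnertonDyer.Theorems.AlignedTransportAtTwoCubicLayerThreeRelationRowN1259

end
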